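import Mathlib
import Summits.Ventures.HodgeRepro2.Tier7.Line3.HeckeWindowElement

/-!
# Tier7/Line3/HeckeWindowWitness — a kernel INSTANCE of every displayed hypothesis of parts VIII–IX (part X of the Hecke-window lane)
(parts I–III = HeckeWindowCounts / HeckeWindowSums / HeckeWindowLocus; IV–V = HeckeWindowIdeal / HeckeWindowIdealOrb;
VI–VII = HeckeWindowSix / HeckeWindowSixOrb; VIII = HeckeWindowSatake; IX = HeckeWindowElement)

Filer: t7-L1-p3 (gen 8, prover-pub-hodge-repro2-t7-L1-p3-g8-0), self-selected on the seat's own TARGET line (STATUS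
l. 15963; twin window held). Lane: Line 3 SUPPORT, referee-facing (README §10.5 (ii)(c)/(d): exhibit an instance of the
displayed hypotheses — the kernel form of the satisfiability probe crit-2 did by hand for part IV, STATUS l. 15763);
NOT a line, NOT a device; touches neither residual clause (a′) nor (b′) of the line.

WHAT IT SHOWS. The hypothesis set of `exists_le_five_window_element` (part IX) — the printed relations (6.3) / (6.6), the
model bridge `hO` / `hOR`, and the datum conditions — is JOINTLY SATISFIABLE on a concrete object, so the theorem is not
vacuous: `A := ℂ[X]`, `R := 1`, `T` the printed recursion `T 0 = 1`, `T 1 = X`, `T (k+2) = X · T (k+1) − q · T k` (so (6.3)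
holds by definition), `q := 4`, `κ := 2⁻¹` (`κ² q = 1`, `‖κ‖ < 1`), `S := aeval (κ⁻¹ (α + β))` for any `α, β` with
`αβ = 1` (so (6.6) is `aeval_X` / `map_one`), the TRIVIAL datum `χ₀ = (1, 1, 1, 1)` (unitary), `c := 1`, `vol := 1`, and
`O := coeffFunctional ℓ : ℂ[X] →ₗ[ℂ] ℂ`, `p ↦ Σ_k coeff_k(p) · ℓ_k`, with `ℓ` the triangular solution of
`O (charFn n) = orbSum χ₀ n 0` (`charFn n` is monic of degree `n`, so `ℓ_n := o_n − Σ_{k<n} coeff_k(charFn n) ℓ_k` solves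
it — `ell`); `hOR` is then automatic (`R = 1`, `e = β₁β₂ = 1`, `orbSum_succ_one`). Applying part IX to the instance
(`witness`): `∃ n ≤ 5, aeval (κ⁻¹(α+β)) (winFn n) = (α − 1)(β − 1) · mac κ α β n ∧ O (winFn n) ≠ 0` — every displayed
hypothesis discharged on a concrete object in the kernel; and since `c = 1 = αβ`-compatible choices include `α = 1`, the
pole-class form applies there (`witness_root`).

WHAT IT DOES NOT SHOW (crit-2's precision (a), STATUS l. 15966): NOTHING about the real datum — no identification is
exercised, the trivial datum `χ₀ = (1, 1, 1, 1)` is a degenerate member of the class, `R = 1` collapses the two bridge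
clauses into one; this file is NOT evidence for residual clause (b′), nor for the non-vanishing of any real orbital sum,
nor for anything about the real `ℋ(GL₂(F_{v₂}) // K)`, the real `O_{γ₀}`, `X`, (N) or (P). It is a «junk model» in the
referees' sense — JOINT SATISFIABILITY of the displayed hypothesis set of `exists_le_five_window_element`, nothing more.
Per crit-2's precision (b), the witness theorems re-type NO hypothesis of part IX: they are `exists_le_five_window_element`
applied to the instance, so the binders can be diffed against p705982's.

§8(d) (uses an L-value-free non-vanishing device): NO — polynomial bookkeeping.
-/

namespace Summit.Ventures.HodgeRepro2.Tier7.Line3.HeckeWindow.Witness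

open Polynomial

/-! ## W1. The polynomial realisation of the printed recursion (6.3) with `R = 1` -/

/-- (W1) `T 0 = 1`, `T 1 = X`, `T (k+2) = X · T (k+1) − q · T k` in `ℂ[X]`: the Hecke relation (6.3) with `R = 1`
holds by definition. -/
noncomputable def Tpoly (q : ℕ) : ℕ → ℂ[X]
  | 0 => 1
  | 1 => X
  | k + 2 => X * Tpoly q (k + 1) - (q : ℂ[X]) * Tpoly q k

/-- `T 0 = 1`. -/
theorem Tpoly_zero (q : ℕ) : Tpoly q 0 = 1 := rfl

/-- `T 1 = X`. -/
theorem Tpoly_one (q : ℕ) : Tpoly q 1 = X := rfl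

/-- `T (k+2) = X · T (k+1) − q · T k`. -/
theorem Tpoly_add_two (q k : ℕ) : Tpoly q (k + 2) = X * Tpoly q (k + 1) - (q : ℂ[X]) * Tpoly q k := rfl

/-- (W1) The printed relation (6.3) for `Tpoly` with `R = 1`, in the binder shape of part IX's `hrec`. -/
theorem Tpoly_rec (q : ℕ) (k : ℕ) (hk : 1 ≤ k) :
    Tpoly q 1 * Tpoly q k = Tpoly q (k + 1) + (q : ℂ[X]) * (1 : ℂ[X]) * Tpoly q (k - 1) := by
  obtain ⟨m, rfl⟩ : ∃ m, k = m + 1 := ⟨k - 1, by omega⟩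
  rw [Tpoly_one, show m + 1 + 1 = m + 2 by omega, Tpoly_add_two, Nat.add_sub_cancel, mul_one]
  ring

/-- (W1) `Tpoly q k` is monic of degree `k`. -/
theorem Tpoly_monic_natDegree (q : ℕ) : ∀ k, (Tpoly q k).Monic ∧ (Tpoly q k).natDegree = k := by
  have key : ∀ k, ((Tpoly q k).Monic ∧ (Tpoly q k).natDegree = k) ∧
      ((Tpoly q (k + 1)).Monic ∧ (Tpoly q (k + 1)).natDegree = k + 1) := by
    intro k
    induction k with
    | zero =>
      refine ⟨⟨monic_one, natDegree_one⟩, ?_⟩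
      show (X : ℂ[X]).Monic ∧ (X : ℂ[X]).natDegree = 1
      exact ⟨monic_X, natDegree_X⟩
    | succ k ih =>
      obtain ⟨⟨hm0, hd0⟩, ⟨hm1, hd1⟩⟩ := ih
      refine ⟨⟨hm1, hd1⟩, ?_⟩
      show (Tpoly q (k + 2)).Monic ∧ (Tpoly q (k + 2)).natDegree = k + 2
      rw [Tpoly_add_two]
      have hXm : (X * Tpoly q (k + 1)).Monic := monic_X.mul hm1
      have hXd : (X * Tpoly q (k + 1)).natDegree = k + 2 := by
        rw [monic_X.natDegree_mul hm1, natDegree_X, hd1]; ring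
      have hlt : ((q : ℂ[X]) * Tpoly q k).natDegree < (X * Tpoly q (k + 1)).natDegree := by
        rw [hXd]
        calc ((q : ℂ[X]) * Tpoly q k).natDegree
            ≤ (q : ℂ[X]).natDegree + (Tpoly q k).natDegree := natDegree_mul_le
          _ = k := by rw [natDegree_natCast, hd0, zero_add]
          _ < k + 2 := by omega
      exact ⟨hXm.sub_of_left (degree_lt_degree hlt), by rw [natDegree_sub_eq_left_of_natDegree_lt hlt, hXd]⟩
  exact fun k => (key k).1

/-- (W1) `charFn (Tpoly q) 1 n` (the printed basis change with `R = 1`) is monic of degree `n`. -/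
theorem charFn_monic_natDegree (q : ℕ) (n : ℕ) :
    (charFn (Tpoly q) 1 n).Monic ∧ (charFn (Tpoly q) 1 n).natDegree = n := by
  match n with
  | 0 => rw [charFn_zero]; exact Tpoly_monic_natDegree q 0
  | 1 => rw [charFn_one]; exact Tpoly_monic_natDegree q 1
  | n + 2 =>
    rw [charFn_add_two, one_mul]
    obtain ⟨hm2, hd2⟩ := Tpoly_monic_natDegree q (n + 2)
    obtain ⟨_, hd0⟩ := Tpoly_monic_natDegree q n
    have hlt : (Tpoly q n).natDegree < (Tpoly q (n + 2)).natDegree := by rw [hd0, hd2]; omega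
    exact ⟨hm2.sub_of_left (degree_lt_degree hlt), by rw [natDegree_sub_eq_left_of_natDegree_lt hlt, hd2]⟩

/-! ## W2. The coefficient functional and the triangular solution -/

/-- (W2) The coefficient functional `p ↦ Σ_k coeff_k(p) · ℓ_k` as a `ℂ`-linear map `ℂ[X] →ₗ[ℂ] ℂ`. -/
noncomputable def coeffFunctional (ℓ : ℕ → ℂ) : ℂ[X] →ₗ[ℂ] ℂ where
  toFun p := p.sum fun k c => c * ℓ k
  map_add' p r := by
    rw [Polynomial.sum_add_index]
    · intro k; simp
    · intro k a b; ring
  map_smul' r p := by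
    simp only [RingHom.id_apply, smul_eq_mul]
    rw [Polynomial.sum_smul_index p r (fun k c => c * ℓ k) (fun k => by simp)]
    simp only [Polynomial.sum_def, Finset.mul_sum]
    refine Finset.sum_congr rfl ?_
    intro k _; ring

/-- `coeffFunctional ℓ p = p.sum (fun k c => c * ℓ k)`. -/
theorem coeffFunctional_apply (ℓ : ℕ → ℂ) (p : ℂ[X]) :
    coeffFunctional ℓ p = p.sum fun k c => c * ℓ k := rfl

/-- (W2) On a monic polynomial of degree `n`: `O P = ℓ n + Σ_{k<n} coeff_k(P) · ℓ_k`. -/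
theorem coeffFunctional_monic (ℓ : ℕ → ℂ) (P : ℂ[X]) (n : ℕ) (hm : P.Monic) (hd : P.natDegree = n) :
    coeffFunctional ℓ P = ℓ n + ∑ k ∈ Finset.range n, P.coeff k * ℓ k := by
  rw [coeffFunctional_apply, Polynomial.sum_over_range' P (fun k => by simp) (n + 1) (by omega),
    Finset.sum_range_succ]
  have h1 : P.coeff n = 1 := by rw [← hd]; exact hm.coeff_natDegree
  rw [h1, one_mul, add_comm]

/-- (W2) The triangular solution: `ℓ_n := o_n − Σ_{k<n} coeff_k(P n) · ℓ_k`. -/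
noncomputable def ell (o : ℕ → ℂ) (P : ℕ → ℂ[X]) : ℕ → ℂ
  | n => o n - ∑ k ∈ (Finset.range n).attach, (P n).coeff k.1 * ell o P k.1
termination_by n => n
decreasing_by exact Finset.mem_range.mp k.2

/-- (W2) For monic `P n` of degree `n`: `coeffFunctional (ell o P) (P n) = o n` for every `n`. -/
theorem coeffFunctional_ell (o : ℕ → ℂ) (P : ℕ → ℂ[X]) (hP : ∀ n, (P n).Monic ∧ (P n).natDegree = n)
    (n : ℕ) : coeffFunctional (ell o P) (P n) = o n := by
  rw [coeffFunctional_monic _ _ n (hP n).1 (hP n).2]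
  have h : ell o P n = o n - ∑ k ∈ Finset.range n, (P n).coeff k * ell o P k := by
    rw [ell, Finset.sum_attach (Finset.range n) (fun k => (P n).coeff k * ell o P k)]
  rw [h]; ring

/-! ## W3. The instance and the witness -/

/-- (W3) The trivial datum `(1, 1, 1, 1)`. -/
def χ₀ : UnramChar := ⟨1, 1, 1, 1, by norm_num⟩

/-- (W3) The trivial datum is unitary. -/
theorem χ₀_unitary : χ₀.Unitary := by
  simp only [UnramChar.Unitary, χ₀, norm_one, and_self]

/-- (W3) The model-bridge clause `hO` on the instance: `O (charFn n) = 1 · orbSum χ₀ n 0`, by the triangular solution. -/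
theorem hO_instance (n : ℕ) :
    coeffFunctional (ell (fun m : ℕ => orbSum χ₀ (m : ℤ) 0) (charFn (Tpoly 4) 1)) (charFn (Tpoly 4) 1 n) =
      1 * orbSum χ₀ (n : ℤ) 0 := by
  rw [one_mul]
  exact coeffFunctional_ell _ _ (charFn_monic_natDegree 4) n

/-- (W3) The model-bridge clause `hOR` on the instance: with `R = 1` and `β₁ β₂ = 1` it is `hO` again
(`orbSum_succ_one`). -/
theorem hOR_instance (n : ℕ) :
    coeffFunctional (ell (fun m : ℕ => orbSum χ₀ (m : ℤ) 0) (charFn (Tpoly 4) 1)) (1 * charFn (Tpoly 4) 1 n) =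
      1 * orbSum χ₀ ((n : ℤ) + 1) 1 := by
  rw [one_mul, orbSum_succ_one, hO_instance]
  simp only [χ₀, one_mul]

/-- (W3) `κ = 2⁻¹`, `q = 4`: `κ² q = 1`. -/
theorem hκq_instance : ((2 : ℂ)⁻¹) ^ 2 * ((4 : ℕ) : ℂ) = 1 := by norm_num

/-- (W3) `‖2⁻¹‖ < 1`. -/
theorem hκ_instance : ‖((2 : ℂ)⁻¹)‖ < 1 := by
  rw [norm_inv]
  have h2 : ‖(2 : ℂ)‖ = 2 := by simp
  rw [h2]; norm_num

/-- (W3) THE WITNESS: part IX's theorem applied to the instance — every displayed hypothesis discharged on a concrete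
object. For any `α β` with `αβ = 1`: one of the six window elements `winFn n ∈ ℂ[X]` has `aeval (2(α+β))`-value
`(α − 1)(β − 1) · mac 2⁻¹ α β n` and non-zero `O`-value. -/
theorem witness (α β : ℂ) (hαβ : α * β = 1) :
    ∃ n, n ≤ 5 ∧
      aeval (2 * (α + β)) (winFn (Tpoly 4) 1 1 (2 : ℂ)⁻¹ n) = (α - 1) * (β - 1) * mac (2 : ℂ)⁻¹ α β n ∧
      coeffFunctional (ell (fun m : ℕ => orbSum χ₀ (m : ℤ) 0) (charFn (Tpoly 4) 1)) (winFn (Tpoly 4) 1 1 (2 : ℂ)⁻¹ n) ≠ 0 := by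
  have hS1 : aeval (2 * (α + β)) (Tpoly 4 1) = ((2 : ℂ)⁻¹)⁻¹ * (α + β) := by
    rw [Tpoly_one, aeval_X, inv_inv]
  have hSR : aeval (2 * (α + β)) (1 : ℂ[X]) = α * β := by rw [map_one, hαβ]
  exact exists_le_five_window_element (Tpoly 4) 1 4 (aeval (2 * (α + β)))
    (coeffFunctional (ell (fun m : ℕ => orbSum χ₀ (m : ℤ) 0) (charFn (Tpoly 4) 1))) χ₀ 1 (2 : ℂ)⁻¹ α β 1
    hκq_instance (Tpoly_zero 4) (Tpoly_rec 4) hS1 hSR hO_instance hOR_instance χ₀_unitary norm_one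
    hκ_instance one_ne_zero

/-- (W3) The pole-class form on the instance with `α = β = 1` (`c = 1 ∈ {α, β}`): one of the six window elements has
`aeval 4`-value `0` and non-zero `O`-value. -/
theorem witness_root :
    ∃ n, n ≤ 5 ∧ aeval (4 : ℂ) (winFn (Tpoly 4) 1 1 (2 : ℂ)⁻¹ n) = 0 ∧
      coeffFunctional (ell (fun m : ℕ => orbSum χ₀ (m : ℤ) 0) (charFn (Tpoly 4) 1)) (winFn (Tpoly 4) 1 1 (2 : ℂ)⁻¹ n) ≠ 0 := by
  obtain ⟨n, hn, hS, hO⟩ := witness 1 1 (by norm_num)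
  refine ⟨n, hn, ?_, hO⟩
  have h4 : (2 : ℂ) * (1 + 1) = 4 := by norm_num
  rw [h4] at hS
  rw [hS]; ring

end Summit.Ventures.HodgeRepro2.Tier7.Line3.HeckeWindow.Witness
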